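import Summits.QuantumFields.YangMills.Theorems.UnitScaleTiltHistoryTailSmallFactorLocal
import Summits.QuantumFields.YangMills.Theorems.UnitScaleTiltHistoryTailWalkLocality
import Literature.MathematicalPhysics.QuantumFieldTheory.Balaban1983to89.T3AlphaInputsAC

/-!
# Route `UnitScaleTilt` — crux K2 `HistoryTail` (stmt-QuantumFields-18916): THE TOP-LEVEL LARGE PLAQUETTE OF A HISTORY — the interface's
# (42)/(67) clause `Constraint42Top` and multi-level (68) clause `Regularity68Levels` FEED the landed local (69)–(71) chain
# `HistoryTailSmallFactorLocal.smallFactor_deterministic_loc` at the composite minimiser (support file; S5b «conditioning», top-level case)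

Fleet lead `ym-ust-18916-p1` (gen 2), 2026-08-26; finding F-g2-1 §F3 (evidence #22) and the v5 proposal c2a4cb896b1b4582 (`stub_conditioning`).  For a
datum `W` with a `θBal(K−j)`-large plaquette `p′` at level `j` and a history `h` whose top region `Ω_j(h)` contains `p′`, the small factor
`e^{−¼p(g_{K−j})²}` of (71) must come from the MAIN TERM `β_K·A(U_j(h, W))` of the (41)-exponent — Bałaban p.273: «Let us take a plaquette p′ ⊂ Λ_j
and such that |V_j(∂p′) − 1| ≥ g_jp(g_j). We have Ū_k^j = V_j on Λ_j (67) and the configuration U_k satisfies the following regularity condition on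
B_j(Λ_j): |U_k(∂p) − 1| < O(1)g_jp(g_j)L^{−2j} (68)».  The interface `T3AlphaInputsAC` (p456617) types (67) as `Constraint42Top` and (68) (with the
consumer's multi-level reading) as `Regularity68Levels`; gen 0 of this seat landed the deterministic chain (69)–(71) for the ROUTE's averaging under
WALK-LOCAL smallness (`HistoryTailSmallFactorLocal`, p448327) and the box-to-walk bridge (`HistoryTailWalkLocality`, p447342).  THIS FILE connects them:

* §1 `plaqHol_iter_umin_eq` / `large_iter_umin` — under `Constraint42Top`, for an admissible pair and a level-`j` plaquette with corners in `Ω_j(h)`,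
  the `j`-fold `ℰp`-average of the composite minimiser HAS the datum's plaquette variable there; so a datum-large plaquette is a large averaged
  plaquette of the minimiser's tower (the hypothesis `hlarge` of the chain);
* §2 `walkLocal_umin_of_regularity68Levels` — under `Regularity68Levels`, if the `ℓ∞`-boxes of radius `(d+2)L + 2` around the block bases of the
  bonds of the nested regions lie (corner-wise) in `Λ_j(h)`, the minimiser's tower is walk-locally `a_s`-small with PRINT's profile
  `a_s = C68·θBal(K−j)·L^{−2(j−s)}` (the hypothesis `hloc` of the chain, via `walkLocal_of_box`);
* §3 **`smallFactor71_top`** — the chain applied: `(p(g_{K−j})² − β_{K−j}·Rem(a, ε, R))/(2Πm) ≤ β_K·Σ_{q ∈ R_0}(1 − Re tr U_j(h,W)(∂q))` for the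
  composite minimiser, with the nested regions `R`, their translated-square closure `hR`, the boxes-in-`Λ_j` hypothesis and `Π(1+ε_s) ≤ Πm` explicit
  — i.e. `SmallFactor71`'s inequality shape for the TOP plaquette modulo the remainder, whose sizing under this profile is `HistoryTailRemainder.remainder_le`.

WHAT THIS IS NOT: the regions under a plaquette (boxes of side `≍ 3L^{j−s}`, cardinality `≤ N₀L^{3(j−s)}`) and the final `¼` are the next brick; nothing
of (41)/(47) is used; no decoupling is claimed.

References: T. Bałaban, CMP 102 (1985) 255–275 [Balaban1985UV3] ((42) p.266, (67)–(71) p.273).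
-/

noncomputable section

open scoped BigOperators

namespace Summit.QuantumFields.YangMills.Theorems.HistoryTailAlphaTopPlaquette

open Literature.MathematicalPhysics.QuantumFieldTheory.Balaban1983to89
open T4Continuum BlockAveraging
open B10Eq47AxialChi (shiftN)
open T3ContinuumYM3Torus T3UnitScaleTilt T3UnitLawDensityEML
open T3AlphaInputsAC
open B10Eq38TorusDomains (plaqsIn)
open B10Eq42TorusConstraint (bondsIn lam42 lam42_self mem_bondsIn_of_mem_plaqsIn)
open Summit.QuantumFields.YangMills.Theorems.HistoryTailWalkLocality (walkLocal_of_box)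
open Summit.QuantumFields.YangMills.Theorems.HistoryTailSmallFactorLocal (smallFactor_deterministic_loc)

variable {F : T3Family} {γ : ℝ} {D : AlphaDataT3 F γ}

/-! ## §1 (42)/(67) at the top level: the averaged minimiser carries the datum's plaquette variables on `Ω_j` -/

/-- The top region of print's `Λ`: `Λ_j(h) = Ω_j(h)` (`lam42_self`). [cite: Balaban1985UV3, (42) p.266] -/
theorem Λ_top (K j : ℕ) (h : D.Hist K j) : D.Λ K j h j = D.Ω K j h j :=
  lam42_self _ _

/-- **(67) FOR A PLAQUETTE**: under `Constraint42Top`, for an admissible pair `(h, W)` and a level-`j` plaquette `p` with its corners in `Ω_j(h)`, the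
`j`-fold `ℰp`-average of the composite minimiser has the plaquette variable of the datum: `Ū^j(U_j(h,W))(∂p) = W(∂p)` — p.273 «Ū_k^j = V_j on Λ_j».
[cite: Balaban1985UV3, (42) p.266 and (67) p.273] -/
theorem plaqHol_iter_umin_eq (h42 : Constraint42Top D) {K j : ℕ} (hjK : j ≤ K) (h : D.Hist K j)
    (W : GaugeField (F.P K) j (Matrix.specialUnitaryGroup (Fin 2) ℂ)) (hadm : D.Adm K j h W)
    (p : Plaq (F.P K) j) (hp : p ∈ plaqsIn j (D.Ω K j h j)) :
    GaugeField.plaqHol (Averaging.iter (fun i => BlockAveraging.blockAvg (P := F.P K) (j := i) ℰp) j (D.Umin K j h W)) p =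
      GaugeField.plaqHol W p := by
  obtain ⟨h1, h2, h3, h4⟩ := mem_bondsIn_of_mem_plaqsIn hp
  have e := fun b (hb : b ∈ bondsIn j (D.Ω K j h j)) => h42 K j h W hjK hadm b hb
  simp only [GaugeField.plaqHol, e _ h1, e _ h2, e _ h3, e _ h4]

/-- **A DATUM-LARGE TOP PLAQUETTE IS A LARGE AVERAGED PLAQUETTE OF THE MINIMISER'S TOWER** (the hypothesis `hlarge` of
`HistoryTailSmallFactorLocal.smallFactor_deterministic_loc` at `U = U_j(h, W)`). [cite: Balaban1985UV3, (67) p.273] -/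
theorem large_iter_umin (h42 : Constraint42Top D) {K j : ℕ} (hjK : j ≤ K) (h : D.Hist K j)
    (W : GaugeField (F.P K) j (Matrix.specialUnitaryGroup (Fin 2) ℂ)) (hadm : D.Adm K j h W)
    (p : Plaq (F.P K) j) (hp : p ∈ plaqsIn j (D.Ω K j h j)) {θ : ℝ} (hlarge : θ ≤ GaugeGroup.dist1 (GaugeField.plaqHol W p)) :
    θ ≤ GaugeGroup.dist1 (GaugeField.plaqHol
      (Averaging.iter (fun _ => BlockAveraging.blockAvg ℰp) j (D.Umin K j h W)) p) := by
  have e := plaqHol_iter_umin_eq h42 hjK h W hadm p hp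
  exact e ▸ hlarge

/-! ## §2 (68) multi-level ⇒ the walk-local smallness of the minimiser's tower near the nested regions -/

/-- **PRINT'S PROFILE FROM `Regularity68Levels`, WALK-LOCALLY**: for an admissible pair and nested regions `R` whose bonds' block bases carry
`ℓ∞`-boxes of radius `(d+2)L + 2` made of plaquettes cornered in `Λ_j(h)`, every plaquette of `Ū^s(U_j(h, W))` the local Stokes chain looks at is within
`a_s = C68·θBal(K−j)·L^{−2(j−s)}` of `1` — the hypothesis `hloc` of `smallFactor_deterministic_loc` (via `HistoryTailWalkLocality.walkLocal_of_box`).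
[cite: Balaban1985UV3, (68) p.273] -/
theorem walkLocal_umin_of_regularity68Levels {b₀ p₀ C68 : ℝ} (h68 : Regularity68Levels D b₀ p₀ C68) {K j : ℕ} (hjK : j ≤ K)
    (h : D.Hist K j) (W : GaugeField (F.P K) j (Matrix.specialUnitaryGroup (Fin 2) ℂ)) (hadm : D.Adm K j h W)
    (R : (s : ℕ) → Finset (Plaq (F.P K) s))
    (hbox : ∀ s, s < j → ∀ p ∈ R (s + 1), ∀ c : PBond (F.P K) (s + 1),
      (c = ⟨p.src, p.μ⟩ ∨ c = ⟨p.src.shift p.μ, p.ν⟩ ∨ c = ⟨p.src.shift p.ν, p.μ⟩ ∨ c = ⟨p.src, p.ν⟩) →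
        ∀ z : Site (F.P K) s,
          (∀ ν, ∃ e : ℤ, |e| ≤ (((F.P K).d + 2) * (F.P K).L + 2 : ℕ) ∧
            z ν = (emb c.src) ν + (e : ZMod ((F.P K).sitesPerDir s))) →
          ∀ (a b : Fin (F.P K).d) (hab : a < b), (⟨z, a, b, hab⟩ : Plaq (F.P K) s) ∈ plaqsIn s (D.Λ K j h j)) :
    ∀ s, s < j → ∀ p ∈ R (s + 1), ∀ c : PBond (F.P K) (s + 1),
      (c = ⟨p.src, p.μ⟩ ∨ c = ⟨p.src.shift p.μ, p.ν⟩ ∨ c = ⟨p.src.shift p.ν, p.μ⟩ ∨ c = ⟨p.src, p.ν⟩) →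
        ∀ v : List (Letter (F.P K).d), v.length ≤ ((F.P K).d + 2) * (F.P K).L + 2 →
          ∀ (a' b' : Fin (F.P K).d) (h' : a' < b'),
            GaugeGroup.dist1 (GaugeField.plaqHol (Averaging.iter (fun _ => BlockAveraging.blockAvg ℰp) s (D.Umin K j h W))
              ⟨walkEnd (emb c.src) v, a', b', h'⟩) ≤
              C68 * θBal F.L γ b₀ p₀ (K - j) * (((F.L : ℝ) ^ (j - s))⁻¹) ^ 2 := by
  intro s hs p hp c hc
  refine walkLocal_of_box _ (emb c.src) (((F.P K).d + 2) * (F.P K).L + 2) fun z hz a b hab => ?_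
  exact h68 K j h W hjK hadm j le_rfl s hs.le ⟨z, a, b, hab⟩ (hbox s hs p hp c hc z hz a b hab)

/-! ## §3 The chain applied to the composite minimiser: (71)'s inequality for the top plaquette, modulo the remainder -/

/-- **(69)–(71) FOR THE TOP-LEVEL LARGE PLAQUETTE OF A HISTORY, AT THE COMPOSITE MINIMISER** (`SU(2)`, `d = 3`): under `Constraint42Top` and
`Regularity68Levels`, for an admissible pair `(h, W)`, a level-`j` plaquette `p′ ⊂ Ω_j(h)` with `θBal(K−j) ≤ |W(∂p′) − 1|`, nested regions
`R_j = {p′} ⊇ … ⊇ R_0` closed under the translated squares of the averaging and whose neighbourhood boxes lie in `Λ_j(h)`, summable weights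
`Π_{s<j}(1+ε_s) ≤ Πm` and PRINT's profile `a_s = C68·θBal(K−j)·L^{−2(j−s)}` small enough for the local Stokes bound (`((d+2)L)²a_s/4 ≤ 1/10`):
`(p(g_{K−j})² − β_{K−j}·Rem)/(2Πm) ≤ β_K·Σ_{q∈R_0}(1 − Re tr U_j(h,W)(∂q))` — the landed `smallFactor_deterministic_loc` fed by §1–§2.  With
`HistoryTailRemainder.remainder_le` (`β_{K−j}·Rem ≤ K·p²·θ²`) this is «the part of the action (1/g_k²)A^η(U_k) localized to … Δ′ … can be bounded from
below by ¼p²(g_j)» for the datum's own large plaquette. [cite: Balaban1985UV3, (67)-(71) p.273] -/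
theorem smallFactor71_top (hγ : 0 < γ) (hγ1 : γ ≤ 1) {b₀ : ℝ} (hb₀ : 0 ≤ b₀) (p₀ : ℝ) {C68 : ℝ} (hC68 : 0 ≤ C68)
    (h42 : Constraint42Top D) (h68 : Regularity68Levels D b₀ p₀ C68)
    {K j : ℕ} (hjK : j ≤ K) (h : D.Hist K j) (W : GaugeField (F.P K) j (Matrix.specialUnitaryGroup (Fin 2) ℂ)) (hadm : D.Adm K j h W)
    (p' : Plaq (F.P K) j) (hp' : p' ∈ plaqsIn j (D.Ω K j h j))
    (hlarge : θBal F.L γ b₀ p₀ (K - j) ≤ GaugeGroup.dist1 (GaugeField.plaqHol W p'))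
    (hθ : ((((3 + 2) * F.L : ℕ) : ℝ) ^ 2 / 4) * (C68 * θBal F.L γ b₀ p₀ (K - j)) ≤ 1 / 10)
    (ε : ℕ → ℝ) (hε : ∀ s, 0 < ε s) {Pm : ℝ} (hprod : ∏ s ∈ Finset.range j, (1 + ε s) ≤ Pm)
    (R : (s : ℕ) → Finset (Plaq (F.P K) s)) (hRj : R j = {p'})
    (hR : ∀ s, s < j → ∀ p ∈ R (s + 1), ∀ (r : Fin (F.P K).d → Fin (F.P K).L), ∀ t ∈ Finset.range (F.P K).L,
      ∀ s' ∈ Finset.range (F.P K).L,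
        (⟨shiftN (shiftN (Site.blockSite p.src r) p.ν t) p.μ s', p.μ, p.ν, p.hμν⟩ : Plaq (F.P K) s) ∈ R s)
    (hbox : ∀ s, s < j → ∀ p ∈ R (s + 1), ∀ c : PBond (F.P K) (s + 1),
      (c = ⟨p.src, p.μ⟩ ∨ c = ⟨p.src.shift p.μ, p.ν⟩ ∨ c = ⟨p.src.shift p.ν, p.μ⟩ ∨ c = ⟨p.src, p.ν⟩) →
        ∀ z : Site (F.P K) s,
          (∀ ν, ∃ e : ℤ, |e| ≤ (((F.P K).d + 2) * (F.P K).L + 2 : ℕ) ∧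
            z ν = (emb c.src) ν + (e : ZMod ((F.P K).sitesPerDir s))) →
          ∀ (a b : Fin (F.P K).d) (hab : a < b), (⟨z, a, b, hab⟩ : Plaq (F.P K) s) ∈ plaqsIn s (D.Λ K j h j)) :
    (B10.pFun b₀ p₀ (Real.sqrt (γ * ((F.L : ℝ)⁻¹) ^ (K - j))) ^ 2 -
        (F.scheme ℰp γ).β (K - j) *
          (∑ s ∈ Finset.range j, (∏ u ∈ Finset.Ico (s + 1) j, ((1 + ε u) * (F.L : ℝ))) *
            ((R (s + 1)).card * ((1 + (ε s)⁻¹) *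
              (435 * (((((3 + 2) * F.L : ℕ) : ℝ) ^ 2 / 4) *
                (C68 * θBal F.L γ b₀ p₀ (K - j) * (((F.L : ℝ) ^ (j - s))⁻¹) ^ 2)) ^ 2) ^ 2)))) / (2 * Pm) ≤
      (F.scheme ℰp γ).β K * ∑ q ∈ R 0, (1 - reTr (GaugeField.plaqHol (D.Umin K j h W) q)) := by
  -- the profile and its two elementary properties
  have hθ0 : 0 ≤ θBal F.L γ b₀ p₀ (K - j) := HistoryTailBoundedHeight.θBal_nonneg' F hγ hγ1 hb₀ p₀ (K - j)
  have hL1 : (1 : ℝ) ≤ F.L := by exact_mod_cast F.hL.2.le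
  have hLpow : ∀ s, (((F.L : ℝ) ^ (j - s))⁻¹) ^ 2 ≤ 1 := fun s => by
    have h1 : (1 : ℝ) ≤ (F.L : ℝ) ^ (j - s) := one_le_pow₀ hL1
    have h2 : ((F.L : ℝ) ^ (j - s))⁻¹ ≤ 1 := inv_le_one_of_one_le₀ h1
    have h3 : 0 ≤ ((F.L : ℝ) ^ (j - s))⁻¹ := inv_nonneg.mpr (le_trans zero_le_one h1)
    nlinarith
  have ha : ∀ s, s < j → 0 ≤ C68 * θBal F.L γ b₀ p₀ (K - j) * (((F.L : ℝ) ^ (j - s))⁻¹) ^ 2 := fun s _ =>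
    mul_nonneg (mul_nonneg hC68 hθ0) (sq_nonneg _)
  have ht : ∀ s, s < j → ((((3 + 2) * F.L : ℕ) : ℝ) ^ 2 / 4) *
      (C68 * θBal F.L γ b₀ p₀ (K - j) * (((F.L : ℝ) ^ (j - s))⁻¹) ^ 2) ≤ 1 / 10 := by
    intro s _
    have hc : 0 ≤ ((((3 + 2) * F.L : ℕ) : ℝ) ^ 2 / 4) * (C68 * θBal F.L γ b₀ p₀ (K - j)) :=
      mul_nonneg (by positivity) (mul_nonneg hC68 hθ0)
    calc ((((3 + 2) * F.L : ℕ) : ℝ) ^ 2 / 4) * (C68 * θBal F.L γ b₀ p₀ (K - j) * (((F.L : ℝ) ^ (j - s))⁻¹) ^ 2)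
        = ((((3 + 2) * F.L : ℕ) : ℝ) ^ 2 / 4) * (C68 * θBal F.L γ b₀ p₀ (K - j)) * (((F.L : ℝ) ^ (j - s))⁻¹) ^ 2 := by ring
      _ ≤ ((((3 + 2) * F.L : ℕ) : ℝ) ^ 2 / 4) * (C68 * θBal F.L γ b₀ p₀ (K - j)) * 1 :=
          mul_le_mul_of_nonneg_left (hLpow s) hc
      _ ≤ 1 / 10 := by rw [mul_one]; exact hθ
  exact smallFactor_deterministic_loc F hγ hγ1 hb₀ p₀ hjK p' (D.Umin K j h W)
    (fun s => C68 * θBal F.L γ b₀ p₀ (K - j) * (((F.L : ℝ) ^ (j - s))⁻¹) ^ 2) ε R hRj ha ht hε hprod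
    (walkLocal_umin_of_regularity68Levels h68 hjK h W hadm R hbox) hR
    (large_iter_umin h42 hjK h W hadm p' hp' hlarge)

end Summit.QuantumFields.YangMills.Theorems.HistoryTailAlphaTopPlaquette

end
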